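import Mathlib
import Literature.NumberTheory.LFunctions.Zhang2022.Section15BEq1517WeightSum
import HarnessLib

/-!
# Zhang (2022), §15 (15.17): the divisor-weight average with the SHARP exponent —
# `Σ_{n≤N} τ₂(n)W(n)/n ≤ C(log(N+1))³`, `Σ_{d,l≤N} τ₂(dl)W(dl)/(dl) ≤ C(log(N+1))⁶`

Topic `Literature/NumberTheory/LFunctions/Zhang2022` (Landau–Siegel audit tree; verdict-neutral).
Y. Zhang, *Discrete mean estimates and the Landau–Siegel zero*, arXiv:2211.02515v1 (2022)
[Zhang2022LandauSiegel] — **an unrefereed manuscript under adjudication; nothing here asserts or denies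
its Theorems 1–2.** Companion of `Section15BEq1517WeightSum` (exponent `k = k(c₀)`): since the local
term of the Euler majorant is `(1 + c₀q^{−9/10})(2/q + O(q^{−2})) = 2/q + O_{c₀}(q^{−19/10})`, the
exponent of `log` does NOT depend on `c₀`; with the tree's `∏_{q<y}(1 + k/q + c/q²) ≤ e^{4k+2c}(log y)^k`
(`SmoothEulerMajorant.prod_primesBelow_one_add_le_log_pow`) one gets the exponent `3` (crudely:
`(1 + c₀q^{−9/10})(2/q + 8/q²) ≤ 3/q + c(c₀)/q²`, splitting at `q ≶ 16c₀²`). This is what the (15.17)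
assembly needs when the termwise error of (15.15) carries a POWER of `𝓛` (the `ρ̃ − 1` residue,
`≪ ‖L(1,χ)‖𝓛²⁷W ≤ 𝓛^{−1995}W` under (A)) rather than `e^{−c𝓛^{1/10}}`:

* `sum_tau_two_mul_weight_div_le_cube` — `∃ C, ∀ N ≥ 2, Σ_{n≤N} τ₂(n)W(n)/n ≤ C(log(N+1))³`;
* `sum_box_tau_two_mul_weight_div_le_six` — `∃ C, ∀ N ≥ 2, Σ_{d,l≤N} τ₂(dl)W(dl)/(dl) ≤ C(log(N+1))⁶`.

Theorems only; no definitions, no facts; nothing about Landau–Siegel zeros.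

## References

* Y. Zhang, arXiv:2211.02515v1 (2022), §15 (15.2) p. 79, (15.15)–(15.17) p. 85.
  [cite: Zhang2022LandauSiegel, §15 (15.17) p.85]
* R. R. Hall, G. Tenenbaum, *Divisors* (1988), §0.2. [cite: HallTenenbaum1988, §0.2]
-/

noncomputable section

open Real Finset

namespace Literature.NumberTheory.LFunctions.Zhang2022.Typed.Section15B

open Literature.NumberTheory.LFunctions.Zhang2022
open Literature.NumberTheory.LFunctions.Zhang2022.MeanSquareMajorant (tau tau_two_apply tau_mul_le tau_nonneg)
open Literature.NumberTheory.LFunctions.Zhang2022.SmoothEulerMajorant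

/-- `Σ_{s≥0} (s+3)(1/2)^s = 8`. [folklore] -/
private theorem hasSum_add_three_mul_half_pow :
    HasSum (fun s : ℕ => ((s : ℝ) + 3) * (1 / 2 : ℝ) ^ s) 8 := by
  have h1 : HasSum (fun s : ℕ => (s : ℝ) * (1 / 2 : ℝ) ^ s) 2 := by
    have h := hasSum_coe_mul_geometric_of_norm_lt_one (𝕜 := ℝ) (r := 1 / 2)
      (by rw [Real.norm_eq_abs]; norm_num)
    norm_num at h
    exact h
  have h2 : HasSum (fun s : ℕ => (1 / 2 : ℝ) ^ s) 2 := by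
    have h := hasSum_geometric_of_lt_one (r := 1 / 2) (by norm_num) (by norm_num)
    norm_num at h
    exact h
  have h := h1.add (h2.mul_left 3)
  have e : (2 : ℝ) + 3 * 2 = 8 := by norm_num
  rw [e] at h
  refine h.congr_fun fun s => ?_
  ring

/-- **The local series, sharply**: for a prime `q` and a weight `w ≥ 0`,
`Σ_{r≥0} (r+2)w/q^{r+1} ≤ w·(2/q + 8/q²)` (first term `2w/q`; the tail `Σ_{s≥0}(s+3)w/q^{s+2}` is at most
`(w/q²)Σ_s(s+3)2^{−s} = 8w/q²`). [folklore] -/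
private theorem local_series_le_sharp {q : ℕ} (hq : q.Prime) {w : ℝ} (hw : 0 ≤ w) :
    Summable (fun r : ℕ => ((r : ℝ) + 1 + 1) * w / (q : ℝ) ^ (r + 1)) ∧
      ∑' r : ℕ, ((r : ℝ) + 1 + 1) * w / (q : ℝ) ^ (r + 1) ≤ w * (2 / q + 8 / (q : ℝ) ^ 2) := by
  have hq2 : (2 : ℝ) ≤ q := by exact_mod_cast hq.two_le
  have hq0 : (0 : ℝ) < q := by linarith
  set f : ℕ → ℝ := fun r => ((r : ℝ) + 1 + 1) * w / (q : ℝ) ^ (r + 1) with hf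
  have hf0 : ∀ r, 0 ≤ f r := fun r => by simp only [hf]; positivity
  -- the tail terms: `f (s+1) = (s+3)w/q^{s+2} ≤ (w/q²)(s+3)(1/2)^s`
  have htail : ∀ s : ℕ, f (s + 1) ≤ w / (q : ℝ) ^ 2 * (((s : ℝ) + 3) * (1 / 2 : ℝ) ^ s) := by
    intro s
    have hpow : (2 : ℝ) ^ s ≤ (q : ℝ) ^ s := pow_le_pow_left₀ (by norm_num) hq2 s
    have h2s : (0 : ℝ) < 2 ^ s := pow_pos (by norm_num) s
    have hqs : (0 : ℝ) < (q : ℝ) ^ s := pow_pos hq0 s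
    have hq2' : (0 : ℝ) < (q : ℝ) ^ 2 := pow_pos hq0 2
    simp only [hf]
    rw [show (q : ℝ) ^ (s + 1 + 1) = (q : ℝ) ^ 2 * (q : ℝ) ^ s by ring,
      show ((((s + 1 : ℕ) : ℝ)) + 1 + 1) = (s : ℝ) + 3 by push_cast; ring, one_div_pow,
      div_le_iff₀ (mul_pos hq2' hqs)]
    calc ((s : ℝ) + 3) * w = w / (q : ℝ) ^ 2 * (((s : ℝ) + 3) * (1 / 2 ^ s)) * ((q : ℝ) ^ 2 * 2 ^ s) := by
          field_simp
      _ ≤ w / (q : ℝ) ^ 2 * (((s : ℝ) + 3) * (1 / 2 ^ s)) * ((q : ℝ) ^ 2 * (q : ℝ) ^ s) := by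
          gcongr
  have hmaj : HasSum (fun s : ℕ => w / (q : ℝ) ^ 2 * (((s : ℝ) + 3) * (1 / 2 : ℝ) ^ s))
      (w / (q : ℝ) ^ 2 * 8) := hasSum_add_three_mul_half_pow.mul_left _
  have htail_sum : Summable (fun s : ℕ => f (s + 1)) :=
    Summable.of_nonneg_of_le (fun s => hf0 _) htail hmaj.summable
  have hs : Summable f := (summable_nat_add_iff 1).mp htail_sum
  refine ⟨hs, ?_⟩
  rw [hs.tsum_eq_zero_add]
  have hf0val : f 0 = 2 * w / q := by simp only [hf]; ring
  have htail_le : ∑' s : ℕ, f (s + 1) ≤ w / (q : ℝ) ^ 2 * 8 :=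
    (htail_sum.tsum_le_tsum htail hmaj.summable).trans hmaj.tsum_eq.le
  rw [hf0val]
  have : w * (2 / q + 8 / (q : ℝ) ^ 2) = 2 * w / q + w / (q : ℝ) ^ 2 * 8 := by ring
  rw [this]
  linarith

/-- **`Σ_{n≤N} τ₂(n)W(n)/n ≤ C(log(N+1))³`** for `N ≥ 2`, with `C` depending only on `c₀ ≥ 0`
(`W(n) = ∏_{q∣n}(1 + c₀q^{−9/10})`): Euler majorant with local weights `a(q,r) = (r+1)(1 + c₀q^{−9/10})`
and local terms `≤ (1 + c₀q^{−9/10})(2/q + 8/q²) ≤ 3/q + c/q²` (`c = 10 + 10(1+c₀)(16c₀² + 1)`, splitting at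
`q ≶ 16c₀²`, where `c₀q^{−9/10} ≤ c₀q^{−1/2} ≤ 1/4` beyond). [cite: Zhang2022LandauSiegel, §15 (15.17) p.85] -/
theorem sum_tau_two_mul_weight_div_le_cube {c₀ : ℝ} (hc₀ : 0 ≤ c₀) :
    ∃ C : ℝ, 0 ≤ C ∧ ∀ N : ℕ, 2 ≤ N →
      ∑ n ∈ Icc 1 N, tau 2 n * (∏ q ∈ n.primeFactors, (1 + c₀ * (q : ℝ) ^ (-(9 / 10 : ℝ)))) / n ≤
        C * Real.log ((N : ℝ) + 1) ^ 3 := by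
  classical
  set cc : ℝ := 10 + 10 * (1 + c₀) * (16 * c₀ ^ 2 + 1) with hcc
  have hcc0 : 0 ≤ cc := by rw [hcc]; positivity
  refine ⟨Real.exp (4 * (3 : ℕ) + 2 * cc), (Real.exp_pos _).le, fun N hN => ?_⟩
  set a : ℕ → ℕ → ℝ := fun q r => ((r : ℝ) + 1) * (1 + c₀ * (q : ℝ) ^ (-(9 / 10 : ℝ))) with ha
  have hw0 : ∀ q : ℕ, 0 ≤ 1 + c₀ * (q : ℝ) ^ (-(9 / 10 : ℝ)) := fun q =>
    zero_le_one.trans (one_le_weight_factor hc₀ q)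
  have ha0 : ∀ q r, 0 ≤ a q r := fun q r => by simp only [ha]; exact mul_nonneg (by positivity) (hw0 q)
  -- the local terms
  have hloc : ∀ q : ℕ, q.Prime →
      Summable (fun r : ℕ => a q (r + 1) / (q : ℝ) ^ (r + 1)) ∧
        ∑' r : ℕ, a q (r + 1) / (q : ℝ) ^ (r + 1) ≤ (3 : ℕ) / (q : ℝ) + cc / (q : ℝ) ^ 2 := by
    intro q hq
    obtain ⟨hs, hle⟩ := local_series_le_sharp hq (hw0 q)
    have hfun : (fun r : ℕ => a q (r + 1) / (q : ℝ) ^ (r + 1)) =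
        fun r : ℕ => ((r : ℝ) + 1 + 1) * (1 + c₀ * (q : ℝ) ^ (-(9 / 10 : ℝ))) / (q : ℝ) ^ (r + 1) := by
      funext r; simp only [ha]; push_cast; ring
    rw [hfun]
    refine ⟨hs, hle.trans ?_⟩
    have hq2 : (2 : ℝ) ≤ q := by exact_mod_cast hq.two_le
    have hq0 : (0 : ℝ) < q := by linarith
    have hq1 : (1 : ℝ) ≤ q := by linarith
    set w : ℝ := 1 + c₀ * (q : ℝ) ^ (-(9 / 10 : ℝ)) with hwdef
    have hwpos : 0 ≤ w := hw0 q
    have hwle : w ≤ 1 + c₀ := by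
      have : (q : ℝ) ^ (-(9 / 10 : ℝ)) ≤ 1 := Real.rpow_le_one_of_one_le_of_nonpos hq1 (by norm_num)
      rw [hwdef]; nlinarith
    push_cast
    rcases le_or_gt ((16 : ℝ) * c₀ ^ 2 + 1) (q : ℝ) with hbig | hsmall
    · -- `q ≥ 16c₀² + 1`: `c₀ q^{−9/10} ≤ c₀ q^{−1/2} ≤ 1/4`
      have hrpow : (q : ℝ) ^ (-(9 / 10 : ℝ)) ≤ (q : ℝ) ^ (-(1 / 2 : ℝ)) :=
        Real.rpow_le_rpow_of_exponent_le hq1 (by norm_num)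
      have hsqrt : 4 * c₀ ≤ Real.sqrt q := by
        rw [Real.le_sqrt (by positivity) hq0.le]
        have e : (4 * c₀) ^ 2 = 16 * c₀ ^ 2 := by ring
        rw [e]; linarith
      have hhalf : c₀ * (q : ℝ) ^ (-(1 / 2 : ℝ)) ≤ 1 / 4 := by
        rw [Real.rpow_neg hq0.le, ← Real.sqrt_eq_rpow]
        rcases eq_or_lt_of_le hc₀ with h0 | hpos
        · rw [← h0]; norm_num
        · have hsq0 : 0 < Real.sqrt q := lt_of_lt_of_le (by positivity) hsqrt
          rw [← div_eq_mul_inv, div_le_iff₀ hsq0]; linarith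
      have hw54 : w ≤ 5 / 4 := by
        rw [hwdef]; nlinarith [mul_le_mul_of_nonneg_left hrpow hc₀]
      have h8 : 0 ≤ 8 / (q : ℝ) ^ 2 := by positivity
      have h2q : 0 ≤ 2 / (q : ℝ) := by positivity
      calc w * (2 / q + 8 / (q : ℝ) ^ 2) ≤ 5 / 4 * (2 / q + 8 / (q : ℝ) ^ 2) :=
            mul_le_mul_of_nonneg_right hw54 (by positivity)
        _ = (5 / 2) / q + 10 / (q : ℝ) ^ 2 := by ring
        _ ≤ 3 / q + cc / (q : ℝ) ^ 2 := by
            have h1 : (5 / 2 : ℝ) / q ≤ 3 / q := div_le_div_of_nonneg_right (by norm_num) hq0.le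
            have h2 : (10 : ℝ) / (q : ℝ) ^ 2 ≤ cc / (q : ℝ) ^ 2 :=
              div_le_div_of_nonneg_right (by rw [hcc]; nlinarith [sq_nonneg c₀]) (by positivity)
            linarith
    · -- `q < 16c₀² + 1`: crude bound, `1/q ≤ (16c₀²+1)/q²`
      have hq' : (q : ℝ) ≤ 16 * c₀ ^ 2 + 1 := hsmall.le
      have hinv : 1 / (q : ℝ) ≤ (16 * c₀ ^ 2 + 1) / (q : ℝ) ^ 2 := by
        rw [div_le_div_iff₀ hq0 (by positivity)]; nlinarith
      have h82 : 8 / (q : ℝ) ^ 2 ≤ 8 / q := by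
        rw [div_le_div_iff₀ (by positivity) hq0]; nlinarith
      calc w * (2 / q + 8 / (q : ℝ) ^ 2) ≤ (1 + c₀) * (2 / q + 8 / (q : ℝ) ^ 2) :=
            mul_le_mul_of_nonneg_right hwle (by positivity)
        _ ≤ (1 + c₀) * (10 / q) := by
            apply mul_le_mul_of_nonneg_left _ (by linarith)
            have e : (10 : ℝ) / q = 2 / q + 8 / q := by ring
            rw [e]; linarith
        _ = 10 * (1 + c₀) * (1 / q) := by ring
        _ ≤ 10 * (1 + c₀) * ((16 * c₀ ^ 2 + 1) / (q : ℝ) ^ 2) :=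
            mul_le_mul_of_nonneg_left hinv (by positivity)
        _ ≤ 3 / q + cc / (q : ℝ) ^ 2 := by
            have h3 : (0 : ℝ) ≤ 3 / q := by positivity
            have : 10 * (1 + c₀) * ((16 * c₀ ^ 2 + 1) / (q : ℝ) ^ 2) ≤ cc / (q : ℝ) ^ 2 := by
              rw [mul_div_assoc', div_le_div_iff₀ (by positivity) (by positivity), hcc]
              nlinarith [sq_nonneg c₀, pow_pos hq0 2]
            linarith
  -- the summand is the majorant `M_a(n)/n`, the range is `(N+1)`-smooth
  have hsummand : ∀ n ∈ Icc 1 N,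
      tau 2 n * (∏ q ∈ n.primeFactors, (1 + c₀ * (q : ℝ) ^ (-(9 / 10 : ℝ)))) / n =
        (∏ q ∈ n.primeFactors, a q (n.factorization q)) / n := by
    intro n hn
    have hn0 : n ≠ 0 := by have := (Finset.mem_Icc.mp hn).1; omega
    congr 1
    rw [tau_two_apply, Nat.card_divisors hn0, Nat.cast_prod, ← Finset.prod_mul_distrib]
    refine Finset.prod_congr rfl fun q _ => ?_
    simp only [ha]; push_cast; ring
  have hA : ∀ n ∈ Icc 1 N, n ∈ Nat.smoothNumbers (N + 1) := by
    intro n hn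
    obtain ⟨h1, h2⟩ := Finset.mem_Icc.mp hn
    rw [Nat.mem_smoothNumbers']
    intro p _ hpn
    have := Nat.le_of_dvd (by omega) hpn
    omega
  rw [Finset.sum_congr rfl hsummand]
  refine (sum_smooth_multMajorant_div_le_prod ha0 (fun q hq => (hloc q hq).1) hA).trans ?_
  have hN3 : 3 ≤ N + 1 := by omega
  have h := prod_primesBelow_one_add_le_log_pow hN3 3 hcc0
    (e := fun q => ∑' r : ℕ, a q (r + 1) / (q : ℝ) ^ (r + 1))
    (fun q _ => tsum_nonneg fun r => div_nonneg (ha0 q _) (pow_nonneg (Nat.cast_nonneg q) _))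
    (fun q hq => (hloc q (Nat.mem_primesBelow.mp hq).2).2)
  simpa only [Nat.cast_add, Nat.cast_one] using h

/-- **`Σ_{d,l≤N} τ₂(dl)W(dl)/(dl) ≤ C(log(N+1))⁶`** for `N ≥ 2` (`τ₂(dl) ≤ τ₂(d)τ₂(l)`,
`W(dl) ≤ W(d)W(l)`, and the cube bound squared). [cite: Zhang2022LandauSiegel, §15 (15.17) p.85] -/
theorem sum_box_tau_two_mul_weight_div_le_six {c₀ : ℝ} (hc₀ : 0 ≤ c₀) :
    ∃ C : ℝ, 0 ≤ C ∧ ∀ N : ℕ, 2 ≤ N →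
      ∑ d ∈ Icc 1 N, ∑ l ∈ Icc 1 N,
        tau 2 (d * l) * (∏ q ∈ (d * l).primeFactors, (1 + c₀ * (q : ℝ) ^ (-(9 / 10 : ℝ)))) /
          ((d : ℝ) * l) ≤ C * Real.log ((N : ℝ) + 1) ^ 6 := by
  obtain ⟨C, hC, hS⟩ := sum_tau_two_mul_weight_div_le_cube hc₀
  refine ⟨C * C, mul_nonneg hC hC, fun N hN => ?_⟩
  set W : ℕ → ℝ := fun n => ∏ q ∈ n.primeFactors, (1 + c₀ * (q : ℝ) ^ (-(9 / 10 : ℝ))) with hW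
  have hW0 : ∀ n, 0 ≤ W n := fun n => zero_le_one.trans (one_le_weight hc₀ _)
  have hterm : ∀ d ∈ Icc 1 N, ∀ l ∈ Icc 1 N,
      tau 2 (d * l) * W (d * l) / ((d : ℝ) * l) ≤ (tau 2 d * W d / d) * (tau 2 l * W l / l) := by
    intro d hd l hl
    have hd0 : (0 : ℝ) < d := by exact_mod_cast (Finset.mem_Icc.mp hd).1
    have hl0 : (0 : ℝ) < l := by exact_mod_cast (Finset.mem_Icc.mp hl).1
    rw [div_mul_div_comm]
    refine div_le_div_of_nonneg_right ?_ (mul_pos hd0 hl0).le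
    calc tau 2 (d * l) * W (d * l) ≤ (tau 2 d * tau 2 l) * (W d * W l) :=
          mul_le_mul (tau_mul_le 2 d l) (weight_mul_le hc₀ d l) (hW0 _)
            (mul_nonneg (tau_nonneg _ _) (tau_nonneg _ _))
      _ = tau 2 d * W d * (tau 2 l * W l) := by ring
  calc ∑ d ∈ Icc 1 N, ∑ l ∈ Icc 1 N, tau 2 (d * l) * W (d * l) / ((d : ℝ) * l)
      ≤ ∑ d ∈ Icc 1 N, ∑ l ∈ Icc 1 N, (tau 2 d * W d / d) * (tau 2 l * W l / l) :=
        Finset.sum_le_sum fun d hd => Finset.sum_le_sum fun l hl => hterm d hd l hl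
    _ = (∑ d ∈ Icc 1 N, tau 2 d * W d / d) * (∑ l ∈ Icc 1 N, tau 2 l * W l / l) := by
        rw [Finset.sum_mul_sum]
    _ ≤ (C * Real.log ((N : ℝ) + 1) ^ 3) * (C * Real.log ((N : ℝ) + 1) ^ 3) := by
        have hlog : 0 ≤ Real.log ((N : ℝ) + 1) := Real.log_nonneg (by
          have : (0 : ℝ) ≤ N := Nat.cast_nonneg N; linarith)
        exact mul_le_mul (hS N hN) (hS N hN) (Finset.sum_nonneg fun l _ => by
          have := hW0 l; have := tau_nonneg 2 l; positivity) (mul_nonneg hC (pow_nonneg hlog 3))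
    _ = C * C * Real.log ((N : ℝ) + 1) ^ 6 := by ring

end Literature.NumberTheory.LFunctions.Zhang2022.Typed.Section15B

end
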